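import Literature.NumberTheory.EllipticCurves.SupersingularTwoSelmerTrivial
import Literature.NumberTheory.EllipticCurves.Rank1Residual.Predicates
import HarnessLib

/-!
# Cell `bsd-f1-sign2` (D-0131 (3) FRONTIER, `p = 2`, non-CM) — candidate ES-C-A: the UNIT LOCUS at `2`
# (`ord₂(L(E,1)/Ω_E) = 0`) of a curve with good supersingular reduction at `2` is exactly
# «`Sel_{2^∞}(E/ℚ) = 0` and `2 ∤ Tam(E)`» — typed candidate of the Euler-system lens (seat `-es`)

HONEST FRAMING (typer seat `bsd-f1-sign2-ty`; HOME `run/shared/lean/pub/bsd-f1-sign2/`, CANDIDATES.md §2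
rows ES-C-A): STATEMENT ONLY — two `@[conjecture] def`s (OPEN obligations, our candidates, NOT published
theorems), one helper predicate, two proved bookkeeping lemmas; nothing asserted, nothing booked, no
named fact, PARTITION: none moved. The search question of the cell is «what is the signed / ± object at
2?»; the `-es` lens answers (MEMO-es.md §0): the signed object an Euler system sees at `2` is the ♭/`X⁺`
object, and on the UNIT LOCUS it is TRIVIAL — this file types the layer-`0` form of that claim.

Source of the statements: `HOME/data-es/Sketch.lean` sha16 bcb79e6976fcc0bd (planner-bsd-f1-sign2-es-g0-0,
`lean check` rc 0), decls `UnitLValueAtTwo`, `SelmerTrivialTamagawaOddOfUnitAtTwo`,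
`UnitOfSelmerTrivialTamagawaOddAtTwo`, `kuriharaOtsuki_of_candidate`, re-filed VERBATIM (hypothesis
spelling = the tree's named fact `kuriharaOtsuki_selmer_trivial_supersingular_two`, Kurihara–Otsuki 2006
Thm. 0.1(2)); REFUTER PASS: REF1-AUDIT-v1.md §1 (sha16 46ab2be9fe56dca7): C-A(→) **SURVIVES
(slice-restatement: on the unit locus equivalent to `BSDp W 2` via tree bookkeeping — a sub-leaf, not a
mechanism)**, C-A(←) **SURVIVES**, `UnitIffAtTwo` = conjunction («carry one of the three, not all» — here:
the two directions as defs, the «iff» as the PROVED `unitIffAtTwo_of`); BC7 `#h21_crux_probe` CLEAN.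
REF2 (literature placement): pending at filing time (MEMO-es: Kurihara–Otsuki Thm. 0.1 is `a₂ = ±2` only
and ASSUMES `ord₂ Tam = 0`; the `a₂ = 0` trace and the Tamagawa CONCLUSION are beyond print).

BC5 WITNESS (census, numbers not adjectives): `HOME/data-es/TABLE-ES-UNIT-v1.tsv` sha16 2a816f914e1323f9
— on all **270/270** unit-locus rows (good supersingular at `2`, `a₂ ∈ {0, ±2}`, rank `0`,
`v₂(L(E,1)/Ω_E) = 0`; source `pub/bsd-2adic/eng2/engine1.json` d8412f327e0740e5 key `ss` joined with
Cremona `allbsd`) the Tamagawa product is ODD (Tate's algorithm, independent of the modular symbol —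
non-circular); refuter-1's own scan: 821/821 unit curves with `N < 10⁴` have `N ≡ ±3 (mod 8)`.
CHEAPEST FALSIFIER: one unit row with `2 ∣ ∏ c_ℓ` (0/270) or with `dim Sel₂ > 0` (two-engine 2-descent
on the 270 rows = data ask D1, pending; prediction 270/270 zeros). WHY NOVEL (MEMO-es §3): the printed
theorem (KO 2006 Thm. 0.1(2)) covers `a₂ = ±2` and takes `ord₂ Tam(E) = 0` as a HYPOTHESIS; C-A(→)
asserts it for all three supersingular traces and OUTPUTS the Tamagawa parity; C-A(←) is the `2`-adic
non-vanishing converse (unfalsifiable on BSD-consistent tables: `Ш_an` is defined from `L/Ω`).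

References: [KuriharaOtsuki2006] Thm. 0.1(2) (pp. 557–558); HOME MEMO-es.md b1294649933b749e §§0, 3;
REF1-AUDIT-v1.md §1; [cite: Miller2011LMS, Def. 1.1] (the currency `BSD(E,p)`).
-/

set_option autoImplicit false

noncomputable section

open scoped Classical

open WeierstrassCurve Literature.NumberTheory.EllipticCurves
  Literature.NumberTheory.EllipticCurves.Rank1Residual

namespace Summit.BirchSwinnertonDyer.Rank1Residual.F1Sign2

/-- **The unit locus at `2`**: `ord₂(L(E,1)/Ω_E) = 0` in the tree's spelling — `L(E,1)/Ω_E` is a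
non-zero rational `t` with `padicValRat 2 t = 0` (`Ω_E = ∫_{E(ℝ)}|ω| = realPeriodRat` of a globally
minimal model; the binder of `kuriharaOtsuki_selmer_trivial_supersingular_two` verbatim).
[cite: KuriharaOtsuki2006, Thm. 0.1 (hypothesis `ord₂(L(E,1)/Ω_E) = 0`, p. 558)] -/
def UnitLValueAtTwo (W : WeierstrassCurve ℚ) [W.IsElliptic] : Prop :=
  ∃ t : ℚ, W.entireLFunction 1 / (W.realPeriodRat : ℂ) = (t : ℂ) ∧ t ≠ 0 ∧ padicValRat 2 t = 0

/-- Unfolding lemma for `UnitLValueAtTwo`. [cite: KuriharaOtsuki2006, Thm. 0.1 (p. 558)] -/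
theorem unitLValueAtTwo_iff (W : WeierstrassCurve ℚ) [W.IsElliptic] :
    UnitLValueAtTwo W ↔
      ∃ t : ℚ, W.entireLFunction 1 / (W.realPeriodRat : ℂ) = (t : ℂ) ∧ t ≠ 0 ∧ padicValRat 2 t = 0 :=
  Iff.rfl

/-- On the unit locus `L(E,1) ≠ 0`. [cite: KuriharaOtsuki2006, Thm. 0.1 (p. 558)] -/
theorem UnitLValueAtTwo.entireLFunction_one_ne_zero {W : WeierstrassCurve ℚ} [W.IsElliptic]
    (h : UnitLValueAtTwo W) : W.entireLFunction 1 ≠ 0 := by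
  obtain ⟨t, ht, ht0, -⟩ := h
  intro h0
  rw [h0, zero_div] at ht
  exact ht0 (by exact_mod_cast ht.symm)

/-- **CANDIDATE ES-C-A (→) `SelmerTrivialTamagawaOddOfUnitAtTwo` (OPEN; cell `bsd-f1-sign2`, lens
`-es`).** For `E/ℚ` (globally minimal) with good reduction at `2` and `2 ∣ a₂` (good SUPERSINGULAR at `2`,
all three traces `a₂ ∈ {0, ±2}`): `ord₂(L(E,1)/Ω_E) = 0` forces `Sel_{2^∞}(E/ℚ) = 0` AND `2 ∤ Tam(E)`
— "the Euler system is EXACT at the bottom of the `ℤ₂`-tower" (MEMO-es §3). Kurihara–Otsuki 2006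
Thm. 0.1(2) is the case `a₂ = ±2` WITH `ord₂ Tam = 0` assumed (`kuriharaOtsuki_of_selmerTrivialTamagawaOdd`
below: this candidate implies the tree's named fact). REF1: SURVIVES (slice-restatement — on its locus
equivalent to `BSDp W 2`). Witness: Tam odd on 270/270 unit rows (TABLE-ES-UNIT-v1.tsv 2a816f914e1323f9).
[cite: KuriharaOtsuki2006, Thm. 0.1 (2) (the printed sub-case; this extension is NOT in print)] -/
@[conjecture] def SelmerTrivialTamagawaOddOfUnitAtTwo : Prop :=
  ∀ (W : WeierstrassCurve ℚ) [W.IsElliptic] [W.IsGloballyMinimal],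
    W.HasGoodReductionAtPrime 2 → (2 : ℤ) ∣ W.frobeniusTrace 2 → UnitLValueAtTwo W →
    (Finite (W.selmerGroupPInfty 2) ∧ Nat.card (W.selmerGroupPInfty 2) = 1) ∧ ¬ 2 ∣ W.tamagawaProduct

/-- **CANDIDATE ES-C-A (←) `UnitOfSelmerTrivialTamagawaOddAtTwo` (OPEN).** The converse (`2`-adic
non-vanishing of the unit class): at a good supersingular `2`, analytic rank `0`, `Sel_{2^∞}(E/ℚ) = 0`
and `2 ∤ Tam(E)` force `ord₂(L(E,1)/Ω_E) = 0`. REF1: SURVIVES (a LOWER bound on {Sel = 0, Tam odd,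
r_an = 0}; `Nat.card = 1` already forces finiteness, the `Finite` binder is redundant-harmless;
unfalsifiable on BSD-consistent tables). [folklore] -/
@[conjecture] def UnitOfSelmerTrivialTamagawaOddAtTwo : Prop :=
  ∀ (W : WeierstrassCurve ℚ) [W.IsElliptic] [W.IsGloballyMinimal],
    W.HasGoodReductionAtPrime 2 → (2 : ℤ) ∣ W.frobeniusTrace 2 → W.analyticRank = 0 →
    Finite (W.selmerGroupPInfty 2) → Nat.card (W.selmerGroupPInfty 2) = 1 → ¬ 2 ∣ W.tamagawaProduct →
    UnitLValueAtTwo W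

/-- **C-A as an «iff» (REF1: "= conjunction; carry one of the three, not all" — so PROVED here from the
two directions, not filed as a third obligation):** at a good supersingular `2` in analytic rank `0`,
`ord₂(L(E,1)/Ω_E) = 0 ⟺ (Sel_{2^∞}(E/ℚ) = 0 ∧ 2 ∤ Tam(E))`. [folklore] -/
theorem unitIffAtTwo_of (h₁ : SelmerTrivialTamagawaOddOfUnitAtTwo)
    (h₂ : UnitOfSelmerTrivialTamagawaOddAtTwo) (W : WeierstrassCurve ℚ) [W.IsElliptic]
    [W.IsGloballyMinimal] (hgood : W.HasGoodReductionAtPrime 2) (hss : (2 : ℤ) ∣ W.frobeniusTrace 2)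
    (hr : W.analyticRank = 0) :
    UnitLValueAtTwo W ↔
      (Finite (W.selmerGroupPInfty 2) ∧ Nat.card (W.selmerGroupPInfty 2) = 1) ∧
        ¬ 2 ∣ W.tamagawaProduct :=
  ⟨fun hu ↦ h₁ W hgood hss hu, fun ⟨⟨hfin, hcard⟩, htam⟩ ↦ h₂ W hgood hss hr hfin hcard htam⟩

/-- **C-A (→) EXTENDS the printed theorem**: on the sub-locus `a₂ = ±2` (with `2 ∤ Tam` granted) it is
exactly the tree's named fact `kuriharaOtsuki_selmer_trivial_supersingular_two` (Kurihara–Otsuki 2006,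
Thm. 0.1 (2)). [cite: KuriharaOtsuki2006, Thm. 0.1 (2)] -/
theorem kuriharaOtsuki_of_selmerTrivialTamagawaOdd (h : SelmerTrivialTamagawaOddOfUnitAtTwo) :
    kuriharaOtsuki_selmer_trivial_supersingular_two := by
  intro W _ _ hgood ha ht _
  have hss : (2 : ℤ) ∣ W.frobeniusTrace 2 := by
    rcases ha with h2 | h2 <;> simp [h2]
  exact (h W hgood hss ht).1

end Summit.BirchSwinnertonDyer.Rank1Residual.F1Sign2

end
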